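import Mathlib.MeasureTheory.Integral.IntervalIntegral.Basic
import Mathlib.Analysis.SpecialFunctions.Trigonometric.Basic
import Literature.Analysis.FluidPDE.VectorCalculus
import Literature.Analysis.FluidPDE.ClassicalSolution
import HarnessLib

-- provenance: harness21/H21/H21/Prelude/FluidKinetic/Vorticity.lean @ 9ebae04 (interim HEAD d8f2665); M5 mechanical rewrite
/-!
# Vorticity, the Biot–Savart law, helicity and circulation

Trunk: FluidKinetic (outline `H21/Outlines/FluidKinetic.md`, item F3 `Vorticity`; notion
`vorticity_biot_savart`).

Physical space is `ℝ³ = EuclideanSpace ℝ (Fin 3)` (the curl of the accepted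
`Literature.Analysis.FluidPDE.curl` lives there); only the circulation `∮_γ v · dl` and Kelvin's theorem are stated
on a general finite-dimensional real inner product space `E`, where they cost nothing more.

## Main definitions

* `Literature.Fluid.vorticity u t = curl (u t)`: the vorticity `ω = ∇ × u` of a time-dependent
  velocity field `u : ℝ → ℝ³ → ℝ³` (Majda–Bertozzi, eq. (1.9), (1.11)).
* `Literature.Fluid.biotSavartKernel x h = (4π‖x‖³)⁻¹ (h × x)` and
  `Literature.Fluid.biotSavart ω x = ∫ K(x − y) ω(y) dy = (4π)⁻¹ ∫ ω(y) × (x − y) / ‖x − y‖³ dy`,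
  the Biot–Savart law recovering a divergence-free velocity from its vorticity
  (Majda–Bertozzi, eqs. (2.10)–(2.12), Prop. 2.16).
* `Literature.Fluid.vorticityDirection ω x = ω(x)/‖ω(x)‖`, the direction field `ξ` of
  Constantin–Fefferman (1993), §1.
* `Literature.Fluid.helicity u = ∫ u · curl u` (Majda–Bertozzi, Prop. 1.11 / eq. (1.58)),
  `Literature.Fluid.circulation v γ = ∮_γ v · dl = ∫₀¹ ⟪v(γ(s)), γ'(s)⟫ ds` (Majda–Bertozzi,
  Prop. 1.11, eq. (1.57), Kelvin's circulation theorem).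
* `Literature.Fluid.IsVorticitySolutionOn S ν u`: the vorticity(-stream) formulation
  `∂ₜω + (u·∇)ω = (ω·∇)u + νΔω`, `ω = curl u`, `div u = 0`, pointwise on `S × ℝ³` with the
  one-sided time derivative `timeDerivWithin S` of `ClassicalSolution`
  (Majda–Bertozzi, eq. (1.33), (2.110), Prop. 1.12 / 2.4).

## Main statements (named facts, all in print)

* `biotSavart_curl_eq_self`, `curl_biotSavart`, `divergence_biotSavart`
  (Majda–Bertozzi, Prop. 2.16, Lemma 2.4).
* `IsClassicalNSSolutionOn.isVorticitySolutionOn` (curl of the momentum equation for a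
  curl-free force; Majda–Bertozzi, Prop. 1.12 / eq. (1.33)). Its converse as vendored here
  (`IsVorticitySolutionOn.exists_pressure`, vorticity ⇒ velocity for *every* time set of unique
  differentiability) is **refuted and deprecated**: see "Retired named facts" below.
* `IsClassicalEulerSolutionOn.helicity_eq` (conservation of helicity),
  `IsClassicalEulerSolutionOn.circulation_eq` (Kelvin's circulation theorem)
  (Majda–Bertozzi, Prop. 1.11).
* `norm_vorticityDirection` (real proof).

## Mathlib search

Mathlib (this pin) has no vorticity, Biot–Savart kernel, helicity or circulation (searched
`Biot`, `helicity`, `vorticity`, `circulation`: none). Used from Mathlib: `crossProduct` (via the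
accepted `Literature.Analysis.FluidPDE.cross`), the Bochner integral, `intervalIntegral`, `deriv`, `Real.pi`,
`InnerProductSpace.laplacian`; from H21: `Fluid.curl`, `Fluid.divergence`, `Fluid.IsDivFree`,
`Fluid.convect`, `Fluid.timeDerivWithin`, `Fluid.IsSmoothSpaceTimeOn`,
`Fluid.IsClassicalNSSolutionOn`, `Fluid.IsClassicalEulerSolutionOn`,
`Fluid.HasUniformRapidDecayOn`.

## Design notes

* Sign convention of the kernel: `K(x) h = (4π‖x‖³)⁻¹ h × x`, so that
  `biotSavart ω x = (4π)⁻¹ ∫ ω(y) × (x − y)/‖x − y‖³ dy = −(4π)⁻¹ ∫ (x − y) × ω(y)/‖x − y‖³ dy`,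
  the curl of the Newtonian potential `(4π‖·‖)⁻¹ * ω` (Majda–Bertozzi, (2.10)–(2.11)).
* Junk values: `biotSavartKernel 0 h = 0` (from `0⁻¹ = 0` and `h × 0 = 0`; the kernel is
  singular at the origin, a null set for the `dy`-integral); `biotSavart ω x = 0` if the
  integrand is not Bochner integrable; `vorticityDirection ω x = 0` where `ω x = 0`
  (Constantin–Fefferman only use `ξ` on `{|ω| > 0}`); `circulation` inherits the junk value `0`
  of `deriv γ` at points of non-differentiability.
* The `ContDiff` scope is **not** opened file-wide (its analyticity token `ω` would clash with
  the vorticity variable name `ω`); it is opened locally where `∞` is needed.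
* `IsClassicalNSSolutionOn.isVorticitySolutionOn` carries `UniqueDiffOn ℝ S` (so that the
  one-sided time derivative commutes with spatial derivatives of the jointly smooth field); the
  conservation laws carry `Convex ℝ S` (an interval, so that zero derivative within `S` forces
  constancy).

## Retired named facts (D-0026 verdict clean-up, 2026-08-15)

* `IsVorticitySolutionOn.exists_pressure` — "vorticity ⇒ velocity formulation":
  `∀ (h : IsVorticitySolutionOn S ν u) (hS : UniqueDiffOn ℝ S), ∃ p, IsClassicalNSSolutionOn S ν 0 u p`
  for **every** time set `S` of unique differentiability — is **false as stated**; it is no longer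
  a named fact of this file but a `@[deprecated]` alias (body unchanged, no term-level users; kept
  rather than deleted so that the name still resolves). Refutation, kept in the tree:
  `Literature.Analysis.FluidPDE.not_isVorticitySolutionOn_exists_pressure`
  (`Literature/Analysis/FluidPDE/NSVorticityIffRefutation.lean`; it negates the `def` body
  verbatim, closed over `S ν u`, without using the name): on
  `S = (-∞, 0] ∪ ⋃ₙ [100⁻ⁿ, 2·100⁻ⁿ]` a velocity that is jointly `C^∞` within `S × ℝ³`, divergence
  free and solves the Euler vorticity formulation admits no jointly smooth pressure (across the
  gaps of `S` there is no mean-value theorem in time). The source works on a time **interval**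
  (Majda–Bertozzi 2002, §2.4.4 Prop. 2.21 and its proof, `(x, t) ∈ ℝ³ × (0, ∞)`:
  "`Dv/Dt − νΔv` is the gradient of some function, say `−p`"); the corrected statement with the
  extra hypothesis `Convex ℝ S` is the **proved** theorem
  `IsVorticitySolutionOn.exists_pressure_of_convex`
  (`Literature/Analysis/FluidPDE/NSVorticityProofs.lean`, downstream of this file, hence not
  re-declared here), packaged with the forward direction as
  `isVorticitySolutionOn_iff_of_convex_holds` there.

## References

* A. J. Majda, A. L. Bertozzi, *Vorticity and Incompressible Flow* (CUP 2002), §1.1 eq. (1.9),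
  (1.11), §1.6 Prop. 1.11 (Kelvin, (1.59)) and Prop. 1.12 (conserved quantities, helicity (1.67)),
  eq. (1.33), §2.1 eqs. (2.10)–(2.12), §2.4 Prop. 2.16 (Hodge/Biot–Savart, (2.94)–(2.95)),
  Prop. 2.21 and Lemma 2.2 (equivalence with the vorticity formulation, (2.109)–(2.112)).
  [MajdaBertozziCUP2002] — the `cite` tags follow the numbering of this printing; some prose
  pointers elsewhere in this file ("Prop. 1.11 (iii)", "Prop. 2.4", "Lemma 2.4") come from another
  printing and mean Prop. 1.12 (iv), Prop. 2.21, Lemma 2.2 respectively.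
* P. Constantin, C. Fefferman, *Direction of vorticity and the problem of global regularity for
  the Navier–Stokes equations*, Indiana Univ. Math. J. 42 (1993), §1.
-/

noncomputable section

open MeasureTheory Set Function Filter Topology
open scoped Laplacian InnerProductSpace RealInnerProductSpace Real

namespace Literature.Analysis.FluidPDE

/-- Local notation for physical space `ℝ³ = EuclideanSpace ℝ (Fin 3)`. -/
local notation "ℝ³" => EuclideanSpace ℝ (Fin 3)

/-! ### Vorticity and the Biot–Savart law -/

/-- The vorticity `ω(t) = curl u(t)` of a time-dependent velocity field `u : ℝ → ℝ³ → ℝ³`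
(time first), Majda–Bertozzi, eq. (1.9)/(1.11): `ω = ∇ × v`. A thin wrapper around the accepted
`Literature.Analysis.FluidPDE.curl` (junk value `0` where `u t` is not differentiable). [folklore] -/
def vorticity (u : ℝ → ℝ³ → ℝ³) (t : ℝ) : ℝ³ → ℝ³ :=
  curl (u t)

/-- Unfolding the vorticity: `vorticity u t = curl (u t)` (Majda–Bertozzi, eq. (1.9)). [folklore] -/
@[simp]
theorem vorticity_apply (u : ℝ → ℝ³ → ℝ³) (t : ℝ) : vorticity u t = curl (u t) :=
  rfl

/-- The vorticity of a `C²` velocity field is divergence free, `div ω = 0`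
(Majda–Bertozzi, §1.1 and eq. (2.95); from `divergence_curl_eq_zero`). [folklore] -/
def divergence_vorticity : Prop :=
  ∀ (u : ℝ → ℝ³ → ℝ³) (t : ℝ) (hu : ContDiff ℝ 2 (u t)) (x : ℝ³),
    VectorCalculus.divergence (vorticity u t) x = 0

/- interim proof relied on results that are now named facts (D-0014); demoted to a fact by the M5 import, proof preserved:
:=
  divergence_curl_eq_zero (u t) hu x
-/

/-- The Biot–Savart kernel of `ℝ³`, `K(x) h = (4π‖x‖³)⁻¹ • (h × x)`, i.e. the linear map
`h ↦ (4π)⁻¹ h × x/‖x‖³` (Majda–Bertozzi, eq. (2.10)–(2.11): `v = K₃ * ω`, `K₃` homogeneous of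
degree `−2`). Junk value at the singularity: `biotSavartKernel 0 h = 0` (`0⁻¹ = 0`,
`h × 0 = 0`), harmless since `{0}` is Lebesgue-null. [folklore] -/
def biotSavartKernel (x h : ℝ³) : ℝ³ :=
  (4 * π * ‖x‖ ^ 3)⁻¹ • cross h x

/-- The documented junk value of the Biot–Savart kernel at the origin: `K(0) h = 0`. [folklore] -/
@[simp]
theorem biotSavartKernel_zero_left (h : ℝ³) : biotSavartKernel 0 h = 0 := by
  simp [biotSavartKernel]

/-- The Biot–Savart kernel is linear in `h`; in particular `K(x) 0 = 0`. [folklore] -/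
@[simp]
theorem biotSavartKernel_zero_right (x : ℝ³) : biotSavartKernel x 0 = 0 := by
  simp [biotSavartKernel, cross]

/-- The **Biot–Savart law**: the velocity induced by a vorticity field `ω : ℝ³ → ℝ³`,
`biotSavart ω x = ∫ K(x − y) ω(y) dy = (4π)⁻¹ ∫ ω(y) × (x − y)/‖x − y‖³ dy`
(Majda–Bertozzi, eqs. (2.10)–(2.12), Prop. 2.16). Bochner integral w.r.t. Lebesgue measure on
`ℝ³`: junk value `0` at points `x` where `y ↦ K(x − y) ω(y)` is not integrable. [folklore] -/
def biotSavart (ω : ℝ³ → ℝ³) (x : ℝ³) : ℝ³ :=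
  ∫ y, biotSavartKernel (x - y) (ω y)

/-- The Biot–Savart velocity of the zero vorticity vanishes. [folklore] -/
@[simp]
theorem biotSavart_zero : biotSavart (0 : ℝ³ → ℝ³) = 0 := by
  funext x
  simp [biotSavart]

/-- The vorticity direction field `ξ(x) = ω(x)/‖ω(x)‖` (Constantin–Fefferman 1993, §1, the unit
vector in the direction of `ω`). Junk value `0` where `ω x = 0` (`0⁻¹ = 0`); Constantin–Fefferman
only evaluate `ξ` on `{x | |ω(x)| > Ω}`. [cite: ConstantinFefferman1993, §1  the unit vector in the direction of] -/
def vorticityDirection (ω : ℝ³ → ℝ³) (x : ℝ³) : ℝ³ :=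
  ‖ω x‖⁻¹ • ω x

/-- Unfolding the vorticity direction (Constantin–Fefferman 1993, §1). [cite: ConstantinFefferman1993, §1] -/
theorem vorticityDirection_apply (ω : ℝ³ → ℝ³) (x : ℝ³) :
    vorticityDirection ω x = ‖ω x‖⁻¹ • ω x :=
  rfl

/-- The vorticity direction is a unit vector wherever the vorticity does not vanish:
`‖ξ(x)‖ = 1` for `ω(x) ≠ 0` (Constantin–Fefferman 1993, §1). [cite: ConstantinFefferman1993, §1] -/
theorem norm_vorticityDirection (ω : ℝ³ → ℝ³) {x : ℝ³} (hx : ω x ≠ 0) :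
    ‖vorticityDirection ω x‖ = 1 := by
  have h : ‖ω x‖ ≠ 0 := norm_ne_zero_iff.2 hx
  rw [vorticityDirection, norm_smul, norm_inv, norm_norm, inv_mul_cancel₀ h]

/-- The vorticity direction vanishes (junk value) exactly where the vorticity does. [folklore] -/
@[simp]
theorem vorticityDirection_eq_zero_iff (ω : ℝ³ → ℝ³) (x : ℝ³) :
    vorticityDirection ω x = 0 ↔ ω x = 0 := by
  refine ⟨fun h => ?_, fun h => by simp [vorticityDirection, h]⟩
  by_contra hx
  have := norm_vorticityDirection ω hx
  rw [h, norm_zero] at this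
  exact zero_ne_one this

/-! ### Helicity and circulation -/

/-- The helicity `H(u) = ∫ ⟪u(x), curl u(x)⟫ dx` of a velocity field on `ℝ³`
(Majda–Bertozzi, Prop. 1.11 (iii), eq. (1.58): conserved by smooth Euler flows). Bochner
integral: junk value `0` if `u · curl u` is not integrable. [folklore] -/
def helicity (u : ℝ³ → ℝ³) : ℝ :=
  ∫ x, ⟪u x, curl u x⟫

section Circulation

variable {E : Type*} [NormedAddCommGroup E] [InnerProductSpace ℝ E]

/-- The circulation `Γ = ∮_γ v · dl = ∫₀¹ ⟪v(γ(s)), γ'(s)⟫ ds` of a vector field `v : E → E`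
around a curve `γ : ℝ → E` parametrised by `[0, 1]` (a loop when `γ 0 = γ 1`)
(Majda–Bertozzi, Prop. 1.11 (i), eq. (1.57), Kelvin's circulation theorem). Interval integral;
inherits the junk value `0` of `deriv γ` where `γ` is not differentiable. [folklore] -/
def circulation (v : E → E) (γ : ℝ → E) : ℝ :=
  ∫ s in (0 : ℝ)..1, ⟪v (γ s), deriv γ s⟫

/-- The circulation of the zero field vanishes. [folklore] -/
@[simp]
theorem circulation_zero_left (γ : ℝ → E) : circulation (0 : E → E) γ = 0 := by
  simp [circulation]

end Circulation

/-! ### The Biot–Savart law inverts the curl -/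

/-- **Biot–Savart representation** (Majda–Bertozzi, Prop. 2.16 with the Liouville uniqueness
argument of §2.4.1): a `C¹`, divergence-free velocity field on `ℝ³` vanishing at infinity whose
vorticity is integrable and bounded is recovered from its vorticity, `u = K₃ * curl u`.
(Sketch: `u − biotSavart (curl u)` is div- and curl-free, hence harmonic, and tends to `0` at
infinity — for `biotSavart (curl u)` by `curl u ∈ L¹ ∩ L^∞`.)
[cite: MajdaBertozziCUP2002, Prop. 2.16 (Hodge decomposition / Biot–Savart law (2.94)–(2.95))] -/
def biotSavart_curl_eq_self : Prop :=
  ∀ (u : ℝ³ → ℝ³) (hu : ContDiff ℝ 1 u) (hdiv : VectorCalculus.IsDivFree u) (hdecay : Tendsto u (cocompact ℝ³) (𝓝 0)) (hint : Integrable (curl u)) (hbdd : ∃ C : ℝ, ∀ x, ‖curl u x‖ ≤ C),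
    biotSavart (curl u) = u

/-- The Biot–Savart velocity of a `C¹`, divergence-free vorticity `ω` with `ω, Dω` integrable and
bounded has curl `ω`: `curl (K₃ * ω) = ω` (Majda–Bertozzi, Prop. 2.16 / Lemma 2.4:
`K₃ * ω = curl (G * ω)` with `G` the Newtonian potential, and
`curl curl (G * ω) = ∇(G * div ω) − Δ(G * ω) = ω`). The compatibility condition `div ω = 0` is
necessary. [cite: MajdaBertozziCUP2002, Prop. 2.16 (ii) and its proof, eqs. (2.92)–(2.97)] -/
def curl_biotSavart : Prop :=
  ∀ (ω : ℝ³ → ℝ³) (hω : ContDiff ℝ 1 ω) (hdiv : VectorCalculus.IsDivFree ω) (hint : Integrable ω) (hint' : Integrable (fun x => fderiv ℝ ω x)) (hbdd : ∃ C : ℝ, ∀ x, ‖ω x‖ ≤ C ∧ ‖fderiv ℝ ω x‖ ≤ C),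
    curl (biotSavart ω) = ω

/-- The Biot–Savart velocity is divergence free: `div (K₃ * ω) = div curl (G * ω) = 0` for a
`C¹` field `ω` with `ω, Dω` integrable and bounded (Majda–Bertozzi, Prop. 2.16, eq. (2.96)).
[cite: MajdaBertozziCUP2002, Prop. 2.16 (proof, eq. (2.96))] -/
def divergence_biotSavart : Prop :=
  ∀ (ω : ℝ³ → ℝ³) (hω : ContDiff ℝ 1 ω) (hint : Integrable ω) (hint' : Integrable (fun x => fderiv ℝ ω x)) (hbdd : ∃ C : ℝ, ∀ x, ‖ω x‖ ≤ C ∧ ‖fderiv ℝ ω x‖ ≤ C),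
    VectorCalculus.IsDivFree (biotSavart ω)

/-! ### The vorticity formulation -/

/-- Classical solutions of the **vorticity formulation** of the incompressible Navier–Stokes
equations with viscosity `ν` on `ℝ³ × S` (Euler for `ν = 0`): `u` is jointly smooth on `S × ℝ³`,
divergence free, and its vorticity `ω = vorticity u = curl u` satisfies
`∂ₜω + (u·∇)ω = (ω·∇)u + νΔω` pointwise on `S × ℝ³` (Majda–Bertozzi, eq. (1.33) and
Prop. 1.12 for Euler, eq. (2.110) / Prop. 2.4 for Navier–Stokes). The time derivative is the
one-sided `timeDerivWithin S` of `Literature.Analysis.FluidPDE.IsClassicalNSSolutionOn`; the pressure is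
eliminated (on a convex time set it is recovered by the proved
`IsVorticitySolutionOn.exists_pressure_of_convex` of `NSVorticityProofs.lean`; for a general
time set of unique differentiability it need not exist,
`not_isVorticitySolutionOn_exists_pressure` of `NSVorticityIffRefutation.lean`). [folklore] -/
structure IsVorticitySolutionOn (S : Set ℝ) (ν : ℝ) (u : ℝ → ℝ³ → ℝ³) : Prop where
  /-- The velocity is jointly smooth on `S × ℝ³`. -/
  smooth_velocity : IsSmoothSpaceTimeOn S u
  /-- The vorticity equation `∂ₜω + (u·∇)ω = (ω·∇)u + νΔω` holds pointwise on `S × ℝ³`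
  (Majda–Bertozzi, (1.33), (2.110)). -/
  vorticity_eq : ∀ t ∈ S, ∀ x,
    timeDerivWithin S (vorticity u) t x + convect (u t) (vorticity u t) x =
      convect (vorticity u t) (u t) x + ν • (Δ (vorticity u t)) x
  /-- Incompressibility `div u(t) = 0` for `t ∈ S`. -/
  divFree : ∀ t ∈ S, VectorCalculus.IsDivFree (u t)

/-- `abbrev` for the Euler case `ν = 0` of the vorticity formulation,
`Dω/Dt = (ω·∇)u` (Majda–Bertozzi, eq. (1.33), Prop. 1.12). [folklore] -/
abbrev IsEulerVorticitySolutionOn (S : Set ℝ) (u : ℝ → ℝ³ → ℝ³) : Prop :=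
  IsVorticitySolutionOn S 0 u

section VorticityFormulation

variable {S : Set ℝ} {ν : ℝ} {f u : ℝ → ℝ³ → ℝ³} {p : ℝ → ℝ³ → ℝ}

open scoped ContDiff in
/-- The time slices of a vorticity solution are smooth. [folklore] -/
theorem IsVorticitySolutionOn.contDiff_velocity (h : IsVorticitySolutionOn S ν u) {t : ℝ}
    (ht : t ∈ S) : ContDiff ℝ ∞ (u t) :=
  h.smooth_velocity.contDiff_slice ht

/-- The vorticity of a vorticity solution is divergence free (`div curl = 0`). [folklore] -/
def IsVorticitySolutionOn.isDivFree_vorticity : Prop :=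
  ∀ (h : IsVorticitySolutionOn S ν u) {t : ℝ} (ht : t ∈ S),
    VectorCalculus.IsDivFree (vorticity u t)

/- interim proof relied on results that are now named facts (D-0014); demoted to a fact by the M5 import, proof preserved:
:= fun x =>
  divergence_vorticity u t ((h.contDiff_velocity ht).of_le (by norm_cast)) x
-/

/-- **Velocity ⇒ vorticity formulation** (Majda–Bertozzi, §1.4 eq. (1.33) and Prop. 2.21,
vorticity equation (2.109)–(2.110)): taking the curl of the momentum equation of a classical
Navier–Stokes solution with a `C¹`, curl-free force (e.g. `f = 0` or `f = ∇φ`) gives the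
vorticity equation, using
`curl ((u·∇)u) = (u·∇)ω − (ω·∇)u` for `div u = 0`, `curl ∇p = 0` and `curl Δ = Δ curl`.
`UniqueDiffOn ℝ S` lets the one-sided time derivative commute with the curl.
[cite: MajdaBertozziCUP2002, Prop. 2.21 (forward direction), eq. (1.33)/(2.109)] -/
def IsClassicalNSSolutionOn.isVorticitySolutionOn : Prop :=
  ∀ (h : IsClassicalNSSolutionOn S ν f u p) (hS : UniqueDiffOn ℝ S) (hf : ∀ t ∈ S, ContDiff ℝ 1 (f t)) (hcurl : ∀ t ∈ S, ∀ x, curl (f t) x = 0),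
    IsVorticitySolutionOn S ν u

/-- **DEPRECATED — REFUTED AS STATED (verdict clean-up 2026-08-15; no longer a named fact); do
not consume `(h : IsVorticitySolutionOn.exists_pressure)`.** "Vorticity ⇒ velocity formulation":
for a vorticity solution on a time set `S` of unique differentiability,
`w = ∂ₜu + (u·∇)u − νΔu` is jointly smooth and curl free on the simply connected `ℝ³`, hence a
gradient `−∇p` with `p` jointly smooth, and `(u, p)` is a classical unforced Navier–Stokes
solution — vendored from Majda–Bertozzi 2002, §2.4.4 Prop. 2.21 (converse direction of the
equivalence) and its proof, p. 70: "`Dv/Dt − νΔv` is the gradient of some function, say `−p`".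

*What is wrong.* The source's time set is an interval (`(x, t) ∈ ℝ³ × (0, ∞)`, eq. (2.109));
this rendering quantifies, through the section implicits `{S} {ν} {u}`, over **every** `S` with
`UniqueDiffOn ℝ S`, which allows gaps of `S` accumulating at a point of `S`, across which there is
no mean-value theorem in time. The universal closure `∀ S ν u, …` is false: on
`S = (-∞, 0] ∪ ⋃ₙ [100⁻ⁿ, 2·100⁻ⁿ]` the velocity equal to the steady planar Euler swirl
`10⁻ⁿ n g(n²(y₀² + y₁²)) (-y₁, y₀, 0)` on the `n`-th piece and to `0` elsewhere is jointly `C^∞`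
within `S × ℝ³`, divergence free and solves the vorticity formulation with `ν = 0`, but admits no
jointly smooth pressure (the centripetal pressure drop is quadratic in the amplitude, the
within-`S` Taylor conditions at `t = 0` only linear). **Refutation (kept):**
`Literature.Analysis.FluidPDE.not_isVorticitySolutionOn_exists_pressure`
(`Literature/Analysis/FluidPDE/NSVorticityIffRefutation.lean`; it negates this body verbatim,
closed over `S ν u`, without using this name), which is why no
`IsVorticitySolutionOn.exists_pressure_holds` can exist. **Corrected statement (proved; not
re-declared here, it lives downstream):** `IsVorticitySolutionOn.exists_pressure_of_convex`
(`Literature/Analysis/FluidPDE/NSVorticityProofs.lean`, extra hypothesis `Convex ℝ S` — exactly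
"`S` is an interval", covering the source and every time set used in the tree), packaged with the
forward direction as `isVorticitySolutionOn_iff_of_convex_holds` there. The body below is kept
word for word and the name survives only as a deprecated alias with no term-level users; do not
use it in new code.
[cite: MajdaBertozziCUP2002, §2.4.4 Prop. 2.21 (converse direction; printed on a time interval — the every-UniqueDiffOn-S rendering below is REFUTED, see docstring)] -/
@[deprecated "refuted as stated (quantifies over every time set S with UniqueDiffOn ℝ S; counterexample: Literature.Analysis.FluidPDE.not_isVorticitySolutionOn_exists_pressure, NSVorticityIffRefutation.lean): use IsVorticitySolutionOn.exists_pressure_of_convex (extra hypothesis Convex ℝ S; proved, NSVorticityProofs.lean)" (since := "2026-08-15")]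
def IsVorticitySolutionOn.exists_pressure : Prop :=
  ∀ (h : IsVorticitySolutionOn S ν u) (hS : UniqueDiffOn ℝ S),
    ∃ p : ℝ → ℝ³ → ℝ, IsClassicalNSSolutionOn S ν 0 u p

/-- **Conservation of helicity** (Majda–Bertozzi, Prop. 1.12 (iv), eq. (1.67)): for a smooth
unforced Euler solution on `ℝ³ × S`, `S` an interval, decaying rapidly in space uniformly in
time and with pressure of polynomial growth (so that all boundary terms vanish, as in the
energy identity `IsClassicalNSSolutionOn.hasDerivWithinAt_kineticEnergy`), the helicity
`∫ u · ω` is independent of `t ∈ S`. [cite: MajdaBertozziCUP2002, Prop. 1.12 (iv), eq. (1.67)] -/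
def IsClassicalEulerSolutionOn.helicity_eq : Prop :=
  ∀ (h : IsClassicalEulerSolutionOn S 0 u p) (hS : Convex ℝ S) (hu : HasUniformRapidDecayOn S u) (hp : ∀ t ∈ S, ∃ (C : ℝ) (k : ℕ), ∀ x, |p t x| ≤ C * (1 + ‖x‖) ^ k) {t₀ t₁ : ℝ} (ht₀ : t₀ ∈ S) (ht₁ : t₁ ∈ S),
    helicity (u t₁) = helicity (u t₀)

end VorticityFormulation

section Kelvin

variable {E : Type*} [NormedAddCommGroup E] [InnerProductSpace ℝ E] [FiniteDimensional ℝ E]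
variable {S : Set ℝ} {u : ℝ → E → E} {p : ℝ → E → ℝ}

/-- **Kelvin's circulation theorem** (Majda–Bertozzi, Prop. 1.11, eq. (1.59), with the transport
formula of §1.6): for a smooth unforced Euler solution on `E × S`, `S` an
interval, the circulation `∮_{C(t)} u · dl` around a closed `C¹` loop `C(t) = X(t, γ)`
transported by the flow is independent of `t ∈ S`. The particle-trajectory map
`X : ℝ → E → E` is a hypothesis: jointly smooth on `S × E` with `∂ₜX(t, a) = u(t, X(t, a))`
(within `S`), Majda–Bertozzi, eq. (1.13); no normalisation `X(t₀, ·) = id` is needed.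
[cite: MajdaBertozziCUP2002, Prop. 1.11 (Kelvin's conservation of circulation), eq. (1.59)] -/
def IsClassicalEulerSolutionOn.circulation_eq : Prop :=
  ∀ (h : IsClassicalEulerSolutionOn S 0 u p) (hS : Convex ℝ S) {X : ℝ → E → E} (hX : IsSmoothSpaceTimeOn S X) (hXu : ∀ t ∈ S, ∀ a, HasDerivWithinAt (fun s => X s a) (u t (X t a)) S t) {γ : ℝ → E} (hγ : ContDiff ℝ 1 γ) (hloop : γ 0 = γ 1) {t₀ t₁ : ℝ} (ht₀ : t₀ ∈ S) (ht₁ : t₁ ∈ S),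
    circulation (u t₁) (X t₁ ∘ γ) = circulation (u t₀) (X t₀ ∘ γ)

end Kelvin

end Literature.Analysis.FluidPDE
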